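import Summits.BirchSwinnertonDyer.Rank1Residual.F1Sign2.KolyvaginSystemGenusTwistAtTwo
import HarnessLib

/-!
# Route ByReductionTypeAtTwo, crux `RankOneAtTwoBigImageOddLocal` (stmt-BirchSwinnertonDyer-23715), line `one_door_analytic`:
# ES-24a `FirstDerivativeModTwo` PROVED — Kolyvagin's first derivative at `2` IS the halved genus half-trace (prime level)

Lead prover seat `bsd-line-fkl-p1` g19 (2026-08-29).  THEOREMS ONLY (standard axioms; no `def`, no named fact, no `sorry`, nothing
conditional).  Helper file `--supports stmt-BirchSwinnertonDyer-23715`; it does not close the crux and BSD is not proved by any of this.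

-es g15's support row ES-24a `FirstDerivativeAtTwo.FirstDerivativeModTwo` (`F1Sign2/HalvedGenusPointFirstLayerAtTwo.lean`, typed with REF1 §152's
repair `ℓ.Prime →`; REF1 §152 / REF2 v43 §1.3: «theorem-grade, elementary group-ring identity, prover target») says: for an odd PRIME `ℓ` and ANY
Kolyvagin–Heegner datum `d` of conductor `ℓ`, `P(ℓ) = T(d) + 2Q` — Kolyvagin's derived point is, modulo `2E(K[ℓ])`, the shifted genus
half-trace `T(d) = Σ_{s ∈ S} s σ_ℓ N_H y(ℓ)` (`N_H = Σ_{j<(ℓ+1)/2} σ_ℓ^{2j}`), because `D_ℓ − σ_ℓ N_H ∈ 2ℤ[σ_ℓ]`.  The all-level form ES-25a₀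
`KolyvaginSystemAtTwo.DerivativeModTwoAllLevels` is already a tree theorem (REF1 §156 (K1), `derivativeModTwoAllLevels_strong`, filed by -ty in
`F1Sign2/KolyvaginSystemGenusTwistAtTwo.lean`) for §25's operator `genusOp ρ σ ℓ y = Σ_{j<(ℓ+1)/2} σ^{2j+1} y`; this file supplies the
dictionary between §24's point `genusHalfTrace d = Σ_s s (σ_ℓ (Σ_j σ_ℓ^{2j} y))` and §25's `genusHalfTraceN d` at a prime level
(`σ^{2j+1} = σ·σ^{2j}`, `ℓ.primeFactorsList = [ℓ]`) and reads ES-24a off (K1):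

* `genusOp_eq_apply_halfNorm` — `genusOp ρ σ ℓ y = ρ σ (Σ_{j<(ℓ+1)/2} ρ (σ^{2j}) y)` for every monoid action;
* `genusOpProd_primeFactorsList_prime` — along the prime-factor list of a prime, `genusOpProd` is one `genusOp`;
* `genusHalfTrace_eq_genusHalfTraceN` — at a prime level `ℓ`, §24's `genusHalfTrace d` = §25's `genusHalfTraceN d`;
* `firstDerivativeModTwo_holds : FirstDerivativeModTwo` — **ES-24a is a theorem** (its `Odd ℓ` binder is idle, like ES-25a₀'s);
* `firstLayerClassVanishes_iff_classVanishesModTwo` — at a prime level the first-layer bit `FirstLayerClassVanishes d` (`T(d) ∈ 2E(K[ℓ])`, §24)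
  is §25's `ClassVanishesModTwo d` (`P(ℓ) ∈ 2E(K[ℓ])`), as -ty's docstring of `ClassVanishesModTwo` asserts in words.

Bears on the crux's open residue after the bottom rung (the `m ≥ 1` door pairs — stubs R₀⁺ / R_S of the line of record v8.17 = Kolyvagin exactness at
`2`): the first Kolyvagin layer at `2` is the halved-genus-point family of -es §24, and its vanishing bit is the same object in §24 and §25.
-/

set_option autoImplicit false
set_option linter.dupNamespace false

noncomputable section

open scoped Classical

namespace Summit.BirchSwinnertonDyer.BirchSwinnertonDyer.Theorems.RankOneAtTwoOneDoor

open WeierstrassCurve NumberField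
open Literature.NumberTheory.EllipticCurves Literature.NumberTheory.EllipticCurves.ModularForms
open Literature.NumberTheory.EllipticCurves.KolyvaginOperator
open Summit.BirchSwinnertonDyer.Rank1Residual.F1Sign2.KolyvaginOperatorTwo
open Summit.BirchSwinnertonDyer.Rank1Residual.F1Sign2.FirstDerivativeAtTwo
open Summit.BirchSwinnertonDyer.Rank1Residual.F1Sign2.KolyvaginSystemAtTwo

/-! ## §1 Operator level: `σ N_H` as `σ` applied to the half norm -/

section Monoid

variable {G : Type*} [Monoid G] {A : Type*} [AddCommMonoid A] (ρ : G →* AddMonoid.End A)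

/-- **`σ N_H y = σ (Σ_{j<(ℓ+1)/2} σ^{2j} y)`**: §25's genus operator `Σ_{j<(ℓ+1)/2} σ^{2j+1} y` is `σ` applied to the half norm of §24
(`σ^{2j+1} = σ·σ^{2j}` and additivity of `ρ σ`). [folklore] -/
theorem genusOp_eq_apply_halfNorm (σ : G) (ℓ : ℕ) (y : A) :
    genusOp ρ σ ℓ y = ρ σ (∑ j ∈ Finset.range ((ℓ + 1) / 2), ρ (σ ^ (2 * j)) y) := by
  simp only [genusOp, map_sum, pow_succ', map_mul]
  rfl

/-- **At a prime `ℓ` the product operator `∏_{p ∣ ℓ} σ_p N_{H_p}` is the single factor `σ_ℓ N_{H_ℓ}`** (`ℓ.primeFactorsList = [ℓ]`).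
[folklore] -/
theorem genusOpProd_primeFactorsList_prime (σ : ℕ → G) {ℓ : ℕ} (hℓ : ℓ.Prime) (y : A) :
    genusOpProd ρ σ ℓ.primeFactorsList y = genusOp ρ (σ ℓ) ℓ y := by
  rw [Nat.primeFactorsList_prime hℓ]
  rfl

/-- The same for Kolyvagin's `D`: at a prime `ℓ`, `D_{[ℓ]} = D_ℓ` in the generator `σ_ℓ`. [folklore] -/
theorem derivOpProd_primeFactorsList_prime (σ : ℕ → G) {ℓ : ℕ} (hℓ : ℓ.Prime) (y : A) :
    derivOpProd ρ σ ℓ.primeFactorsList y = derivOp ρ (σ ℓ) ℓ y := by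
  rw [Nat.primeFactorsList_prime hℓ]
  rfl

end Monoid

/-! ## §2 Point level: §24's `genusHalfTrace` is §25's `genusHalfTraceN` at a prime level; ES-24a -/

section Level

variable {N : ℕ} [NeZero N] {W : WeierstrassCurve ℚ} {K : Type} [Field K] [NumberField K]
  {Dt : ModularParametrizationData W N} {β : ℤ} {ι : K →+* ℂ} {ℓ : ℕ}

/-- **§24 ⟷ §25 at a prime level**: for a Kolyvagin–Heegner datum `d` of PRIME conductor `ℓ`, -es g15's shifted genus half-trace
`genusHalfTrace d = Σ_{s∈S} s (σ_ℓ (Σ_{j<(ℓ+1)/2} σ_ℓ^{2j} y(ℓ)))` equals -es g16's `genusHalfTraceN d = Σ_{s∈S} s ((∏_{p∣ℓ} σ_p N_{H_p}) y(ℓ))`.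
[folklore] -/
theorem genusHalfTrace_eq_genusHalfTraceN (hℓ : ℓ.Prime) (d : KolyvaginHeegnerData Dt β ι ℓ) :
    genusHalfTrace d = genusHalfTraceN d := by
  simp only [genusHalfTrace, halfNorm, genusHalfTraceN, genusDerivedPoint, genusOpProd_primeFactorsList_prime _ _ hℓ,
    genusOp_eq_apply_halfNorm]

/-- **ES-24a at a prime level, unguarded**: `P(ℓ) = T(d) + 2Q` for EVERY prime `ℓ` (no parity hypothesis) and every datum `d` of conductor `ℓ`
— REF1 §156 (K1) `derivativeModTwoAllLevels_strong` read through `genusHalfTrace_eq_genusHalfTraceN`. [cite: GrossLMS1991, §3 (3.5), §4 (4.1)] -/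
theorem exists_derivedPoint_eq_genusHalfTrace_add_two (hℓ : ℓ.Prime) (d : KolyvaginHeegnerData Dt β ι ℓ) :
    ∃ Q : (W.baseChange (ringClassField K ι ℓ)).toAffine.Point, d.derivedPoint = genusHalfTrace d + 2 • Q := by
  rw [genusHalfTrace_eq_genusHalfTraceN hℓ]
  exact derivativeModTwoAllLevels_strong d

/-- **The first-layer bit is one object in §24 and §25**: at a prime level `ℓ`, `T(d) ∈ 2E(K[ℓ])` (§24's `FirstLayerClassVanishes d`) iff
`P(ℓ) ∈ 2E(K[ℓ])` (§25's `ClassVanishesModTwo d`), since `P(ℓ) − T(d) ∈ 2E(K[ℓ])`. [folklore] -/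
theorem firstLayerClassVanishes_iff_classVanishesModTwo (hℓ : ℓ.Prime) (d : KolyvaginHeegnerData Dt β ι ℓ) :
    FirstLayerClassVanishes d ↔ ClassVanishesModTwo d := by
  obtain ⟨R, hR⟩ := exists_derivedPoint_eq_genusHalfTrace_add_two hℓ d
  constructor
  · rintro ⟨Q, hQ⟩
    exact ⟨Q + R, by rw [hR, hQ, smul_add]⟩
  · rintro ⟨Q, hQ⟩
    refine ⟨Q - R, ?_⟩
    rw [smul_sub, ← hQ, hR, add_sub_cancel_right]

end Level

/-- **ES-24a `FirstDerivativeModTwo` PROVED** (-es g15 MEMO-es §24; REF1 §152 prover target; REF2 v43 §1.3 «no Literature fact owed»): for an odd prime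
`ℓ` and ANY Kolyvagin–Heegner datum of conductor `ℓ`, Kolyvagin's derived point is the shifted genus half-trace modulo `2E(K[ℓ])`:
`P(ℓ) = T(d) + 2Q`.  The `Odd ℓ` binder is idle (`exists_derivedPoint_eq_genusHalfTrace_add_two` holds at `ℓ = 2` too).
[cite: GrossLMS1991, §3 (3.5), §4 (4.1)] -/
theorem firstDerivativeModTwo_holds : FirstDerivativeModTwo :=
  fun _N _ _W _K _ _ _Dt _β _ι _ℓ _hodd hℓ d => exists_derivedPoint_eq_genusHalfTrace_add_two hℓ d

end Summit.BirchSwinnertonDyer.BirchSwinnertonDyer.Theorems.RankOneAtTwoOneDoor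

end
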